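import Literature.MathematicalPhysics.QuantumFieldTheory.OSData
import HarnessLib

/-!
# A non-trivial, massive, Euclidean-invariant one-field OS family on `ℝ⁴` exists (named fact)

The existence of ONE family of Schwinger functions `𝔖ₙ ∈ 𝒮'((ℝ⁴)ⁿ)` of a single hermitian scalar Euclidean field
with: E0 (normalisation `𝔖₀ = 1`, hermiticity), E0' (linear growth), E2 (reflection positivity), E3 (symmetry),
E4 (cluster property) in the typed forms of `Literature.MathematicalPhysics.AQFT.OSAxiomsSchwinger` (as distributions on
`⁰𝒮`, time = coordinate `0`); E1 in the strong form "invariant under every translation and every linear isometry of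
`ℝ⁴` on `⁰𝒮`"; the mass gap `OSData`-style (`LabelledSchwingerFamily.HasMassGap Δ`, `Δ > 0`: uniform exponential
clustering of ALL truncations at reflected, time-translated pairs); and a non-vanishing truncated two-point function at one
reflected pair (the field is not a c-number).

The free scalar field of mass `m > 0` is such a family: Glimm–Jaffe (1987), §6.2 (Gaussian measure `dφ_C`,
`C = (−Δ + m²)⁻¹`, Prop. 6.2.2, Thm. 6.2.3), Thm. 6.2.4 / Cor. 6.2.7 (the free Hamiltonian is `dΓ(μ)`, `μ ≥ m`:
exponential clustering at rate `m` of every truncated Schwinger function at time-separated arguments), Prop. 6.2.5 and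
Thm. 7.10.1 (reflection positivity), §6.1 / Ch. 19 (OS0–OS4 ⇒ E0'–E4); Osterwalder–Schrader (1973, 1975). Its
two-point function `C(θf, f) > 0` for `f ≠ 0` supported at positive times.

## Why a named fact, and how to discharge it here

The tree constructs the free field MEASURE and proves its measure-form OS axioms
(`freeFieldMeasure`, `freeFieldMeasure_spec_holds`, `IsFreeField.isOSMeasure_holds`,
`IsOSMeasure.exists_isOSFamily'_holds` giving a `SchwingerFamily` with `IsOSFamily`, `IsOSMeasure.hasProductGrowth` +
`HasProductGrowth.hasLinearGrowth_holds` for E0', `IsFreeField.hasExponentialClustering_holds` for the TWO-point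
clustering, `IsFreeField.twoPoint_eq_holds`). Missing for a discharge `isotropicOSFamilyExists_holds`: (i) the bridges from
the one-field `ℕ`-indexed E2/E4 of `QuantumLattice.SchwingerOSAxioms` to the `Fin N`-indexed labelled forms (regrouping
by degree), (ii) hermiticity E0h from reality + E3 + E1, (iii) exponential clustering of ALL truncations
`𝔖ₙ₊ₘ(θF* ⊗ T_t G) − 𝔖ₙ(θF*)𝔖ₘ(G)` of the Gaussian family (Wick expansion: every surviving pairing has a cross pair,
each cross covariance is `O(e^{−mt})`), (iv) positivity `C(θf, f) > 0` for one bump. Consumed by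
`Summits/QuantumFields/YangMills/Theorems/CurvatureAmnesia/Negative/ModelBlindFalse.lean` (negative lemma on crux
stmt-QuantumFields-16192), which takes the clauses as explicit hypotheses.

-- TODO(general form): every dimension `d ≥ 1` and every mass `m > 0`; stated for `d = 4`, the case consumed.
-/

noncomputable section

namespace Literature.MathematicalPhysics.QuantumFieldTheory

open scoped SchwartzMap
open Literature.MathematicalPhysics.QuantumLattice Literature.MathematicalPhysics.AQFT

/-- **A non-trivial, massive, Euclidean-invariant one-field OS family on `ℝ⁴` exists** (e.g. the free scalar field
of mass `m > 0`): there is `S : SchwingerFamily ℝ⁴` whose `Unit`-labelled family satisfies E0 (normalisation and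
hermiticity), E0', E2, E3, E4 as typed in the tree, which is invariant on `⁰𝒮` under every translation and every linear
isometry, has `HasMassGap Δ` for some `Δ > 0`, and whose truncated two-point function does not vanish at some reflected
pair of time-ordered one-point test functions. Known theorem (the free field, Glimm–Jaffe §6.2, Thms. 6.2.3–6.2.4,
Prop. 6.2.5, Thm. 7.10.1, Ch. 19); proof deferred — see the module docstring for the tree's partial discharge.
[cite: GlimmJaffe1987, §6.2 Thm. 6.2.4 and Ch. 19] -/
def IsotropicOSFamilyExists : Prop :=
  ∃ S : SchwingerFamily (EuclideanSpace ℝ (Fin 4)),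
    S.toLabelled.IsNormalized ∧ S.toLabelled.IsHermitian ∧ S.toLabelled.HasLinearGrowth ∧
    S.toLabelled.IsReflectionPositive ∧ S.toLabelled.IsSymmetric ∧ S.toLabelled.HasClusterProperty ∧
    (∀ (n : ℕ) (a : EuclideanSpace ℝ (Fin 4)) (F : 𝓢((Fin n → EuclideanSpace ℝ (Fin 4)), ℂ)),
      IsOffDiagonal F → S n (translateMulti a F) = S n F) ∧
    (∀ (R : EuclideanSpace ℝ (Fin 4) ≃ₗᵢ[ℝ] EuclideanSpace ℝ (Fin 4)) (n : ℕ)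
      (F : 𝓢((Fin n → EuclideanSpace ℝ (Fin 4)), ℂ)), IsOffDiagonal F → S n (linActMulti R F) = S n F) ∧
    (∃ Δ : ℝ, 0 < Δ ∧ S.toLabelled.HasMassGap Δ) ∧
    ∃ (F₁ G₁ : 𝓢((Fin 1 → EuclideanSpace ℝ (Fin 4)), ℂ)) (H₁ : 𝓢((Fin (1 + 1) → EuclideanSpace ℝ (Fin 4)), ℂ)),
      IsTimeOrdered F₁ ∧ IsTimeOrdered G₁ ∧ IsAppendTensorOf H₁ (osAdjoint F₁) G₁ ∧
        S (1 + 1) H₁ ≠ S 1 (osAdjoint F₁) * S 1 G₁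

end Literature.MathematicalPhysics.QuantumFieldTheory

end
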